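import Literature.MathematicalPhysics.QuantumFieldTheory.BalabanImbrieJaffe1984to88.BIJ88RenormTransf311
import Literature.MathematicalPhysics.QuantumFieldTheory.BalabanImbrieJaffe1984to88.BIJ85RT37Normalization

/-!
# `BalabanImbrieJaffe1984to88.BIJ88RT311Exists` — T. Bałaban, J. Imbrie, A. Jaffe, *Effective action and cluster properties of the
abelian Higgs model*, Commun. Math. Phys. **114** (1988) 257–315 [BalabanImbrieJaffe1988], p. 266 **(3.11)**: EXISTENCE of the
renormalized density `ρ₁^L(v, ψ)` — the measure-level renormalization transformation `𝒯` of T. Bałaban, J. Imbrie, A. Jaffe,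
*Renormalization of the Higgs model: minimizers, propagators and the stability of mean field theory*, Commun. Math. Phys. **97** (1985)
299–329 [BalabanImbrieJaffe1985] (3.3) (`BIJ85RT33.RTData.rt`, a Radon–Nikodym density) SATISFIES the push-forward identity by which
(3.11) is typed in the tree (`BIJ88RenormTransf311.IsRT311`, unit `lit-balaban-r18`, file of record of rows C2.Eq3.11/C2.Eq3.13).

statement-level skeleton of published theorems with citation tags; proofs where landed; nothing here is a claim about the Yang–Mills mass gap

PDFs held: `paper:balaban1988-cmp114-bij-abelian-higgs-effective-action` (journal page = PDF page + 256; p. 266 [PDF 10] read on the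
poppler renders `pages/c2-p011a.png`, `c2-p011b.png` of this seat's folder) and `paper:balaban1985-cmp97-bij-higgs-minimizers`
(journal page = PDF page + 298; p. 306 [PDF 8], renders `pages/c1-p008a.png`, `c1-p008b.png`).

CITATION HEADER (lean-in-tree rule).  Part of the lit-balaban TYPED SKELETON (HOME `run/shared/lean/pub/lit-balaban/`), PHASE-2 proof
seat p34 (gen 2, unit `lit-balaban-p34-g2`), file 3/3 after `BIJ85RT33` ((3.3)–(3.6) of [BalabanImbrieJaffe1985] typed at measure level)
and `BIJ85RT37Normalization` ((3.7) proved).  Rows C2.Eq3.11 / C2.Eq3.13 are OWNED AND LANDED by r18 (`BIJ88RenormTransf311`: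
`IsRT311`, `axialBonds`, `axialMeasure`, `gaussWeight`, `rho0`, `eq313`); this file is the EXISTENCE BRIDGE ruled by the row owner
(HOME/lit-balaban-p34/INBOX.md 2026-08-21T03:18Z/03:39Z): it re-declares NOTHING of r18's and restates neither (3.11) nor (3.13).

THE PRINTED TEXT (p. 266 [PDF 10], verbatim).  *"We begin to compute [F] by integrating over u, φ under constraints given by the
block fields v, ψ on the L-lattice. This is the renormalization transformation, described in the previous paper. With the gauge fix
δ_{Ax}(u), it takes the density ρ₀(u, φ) to ρ₁^L(v, ψ) = ∫𝒟u𝒟φ δ(v/Qu)δ_{Ax}(u)F exp[−Σ_p e₀⁻²(1 − Re u(p)) − ½aL⁻²⟨ψ − Q(u)φ,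
ψ − Q(u)φ⟩ − ½⟨φ, −Δ_uφ⟩ − Σ_x P₀(φ(x)) − Σ_x ½δm²ε²|φ(x)|² − ℰ₀ − E^{(0)} − E₁]. (3.11)"*; [BalabanImbrieJaffe1985] p. 306 [PDF 8]:
*"(𝒯e^{−S})(v, ψ) = ∫ e^{−S(u,φ)} δ_{Ax}(u) δ(v/Qu) δ_H(ψ − Qφ) 𝒟u𝒟φ. (3.3)"*.

WHAT IS PROVED, and how.
* §1 `gaussApprox`: r18's normalized `ψ`-Gaussian `BIJ88RenormTransf311.gaussWeight a` of (3.11)–(3.12) IS an approximate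
  δ-function datum `BIJ85RT33.ApproxDelta` ([BalabanImbrieJaffe1985] (3.6) with `a′ = aL^{d−2}` in `L`-lattice units; unit mass =
  r18's `integral_gaussWeight`); `axialRTData`: a block-averaging datum `BIJ85RT33.RTData` whose frozen bond set IS r18's concrete
  axial forest `BIJ88RenormTransf311.axialBonds` (tree order `treeOrder_axialBonds`), for any measurable block averages `Qu`, `Q(u)φ`
  with the Haar regularity `(Qu)_*(∫𝒟u δ_{Ax}(u)·) ≪ dv` ([BalabanImbrieJaffe1985] Sect. 2; hypothesis `hac`).
* §2 kernel: for such a datum `D` (any `D` with `D.tree = axialBonds`), `∫𝒟u δ_{Ax}(u)(·)` of r18 (`axialMeasure`) is the law of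
  `D.ax = (· )[axialBonds := 1]` (`axialMeasure_eq_map_ax`), and the push-forward calculus of the Radon–Nikodym densities of
  `BIJ85RT33` against a bounded measurable test function `g(v, ψ)`: `∫𝒟v𝒟ψ (𝒯ρ)·g = ∫𝒟u𝒟ψ G(u[T := 1], ψ) g(Q(u[T := 1]), ψ)`
  (`integral_rt_mul`; Mathlib `Measure.integral_rnDeriv_smul`, `integral_withDensity_eq_integral_toReal_smul₀`, `integral_map`),
  and Fubini over `𝒟φ dψ` at fixed `u` (`integral_smear_mul`).
* §3 **EXISTENCE for (3.11)**, `isRT311_rt`: for `a > 0`, `d ≥ 2`, every datum `D` over `axialBonds` and every density `ρ₀(u, φ)` that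
  is jointly measurable, jointly gauge invariant and `𝒟u𝒟φ`-integrable (or just `𝒟u𝒟φ`-integrable in the axial gauge,
  `isRT311_rt_of_integrable_ax`), the density `ρ₁ := D.rt (gaussApprox) ρ₀` of [BalabanImbrieJaffe1985] (3.3) satisfies r18's
  `IsRT311 D.qU D.qH a ρ₀ ρ₁`, and it is `dv dψ`-integrable (`integrable_rt_of_integrable_ax`).  Consequently r18's (3.13) `eq313`
  applies to a CONSTRUCTED `ρ₁^L` (`eq313_rt`: its `IsRT311` hypothesis discharged; nothing of (3.13) is re-proved here).
* §4 (v1.1, append-only) **NON-VACUITY of the Haar regularity**: for the crossing-bond decimation `crossAvg U c = U(crossBond c)`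
  (`crossBond c` = the bond of the straight line of `c` of `Balaban1983to89.AveragingRT` that leaves the block `B(c₋)`; never a tree
  bond of `axialBonds`, injective in `c`) the law under `∫𝒟u δ_{Ax}(u)(·)` is EXACTLY `dv` (`map_crossAvg_axialMeasure`, Weil right-invariance
  as in `AveragingRT.map_axialAvg`); hence the datum `crossRTData hj qH` over `axialBonds` with NO hypothesis on the gauge average, and
  `isRT311_crossRTData` / `eq313_crossRTData`: (3.11)-existence and (3.13) with only the `𝒟u𝒟φ`-integrability of `ρ₀` as hypothesis.
NOT DONE HERE (honest scope).  The Haar regularity `hac` of THE PRINTED `U(1)` block average (2.10) of [BalabanImbrieJaffe1985] on the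
torus (decls of record `BIJ85AxialGauge35.qU`, `BIJ85Sect1Model.argB` on `ℤ^d`) is a HYPOTHESIS, as in `BIJ85RT33.RTData.ac_qU`
(GAPS G-C2-04) — §4 discharges it for the crossing-bond decimation only; the `𝒟u𝒟φ`-integrability of the model's `rho0` is a
hypothesis of `eq313_rt` / `eq313_crossRTData`.  Imports: r18's `BIJ88RenormTransf311` and this seat's `BIJ85RT37Normalization` only;
no `Prop`-valued fact is introduced; standard axioms.
-/

namespace Literature.MathematicalPhysics.QuantumFieldTheory.BalabanImbrieJaffe1984to88.BIJ88RT311Exists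

open Literature.MathematicalPhysics.QuantumFieldTheory.Balaban1983to89
open BIJ88Sect3Statements (U1 toC bracket actionU1)
open BIJ85Sect1Model (HiggsField)
open BIJ85RT33 BIJ85RT33.RTData BIJ85RT33.ApproxDelta BIJ85RT37Normalization
open BIJ88RenormTransf311 (axialBonds blockRank treeOrder_axialBonds axialMeasure gaussWeight gaussWeight_pos integral_gaussWeight
  IsRT311 rho0 rho0_gaugeAct measurable_rho0 eq313)
open T4AxialGaugeFixing (TreeOrder fixBonds measurable_fixBonds)
open GaugeField (gaugeAct GaugeInvariant)
open scoped BigOperators ENNReal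
open _root_.MeasureTheory _root_.MeasureTheory.Measure Complex

noncomputable section

variable {P : Params} {j : ℕ}

/-! ## §1 The data of (3.11) as data of [BalabanImbrieJaffe1985] (3.3): the `ψ`-Gaussian and the axial forest -/

/-- kernel: r18's `ψ`-Gaussian `exp(−½aL⁻²⟨ψ − c, ψ − c⟩ − E^{(0)})` is jointly measurable in `(c, ψ)`. [cite: BalabanImbrieJaffe1988, (3.11) p.266] -/
theorem measurable_gaussWeight (a : ℝ) :
    Measurable (Function.uncurry (gaussWeight (P := P) (j := j) a)) := by
  change Measurable fun p : HiggsField P (j + 1) × HiggsField P (j + 1) => gaussWeight a p.1 p.2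
  unfold gaussWeight
  refine Real.measurable_exp.comp (Measurable.sub_const (Measurable.const_mul ?_ _) _)
  refine Finset.measurable_sum _ fun y _ => Measurable.const_mul ?_ _
  exact (((measurable_pi_apply y).comp measurable_snd).sub ((measurable_pi_apply y).comp measurable_fst)).norm.pow_const 2

/-- **The `ψ`-Gaussian of (3.11), normalized by (3.12), is an approximate δ-function `δ_H` in the sense of [BalabanImbrieJaffe1985] (3.6)**
(`BIJ85RT33.ApproxDelta`: jointly measurable, nonnegative, unit `dψ`-mass for every centre — r18's `gaussWeight_pos`,
`integral_gaussWeight`; `a > 0`, `d ≥ 2`). [cite: BalabanImbrieJaffe1988, (3.12) p.267] -/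
def gaussApprox {a : ℝ} (ha : 0 < a) (hd : 2 ≤ P.d) : ApproxDelta P j where
  K := gaussWeight a
  measurable_K := measurable_gaussWeight a
  K_nonneg c ψ := (gaussWeight_pos a c ψ).le
  integral_K := integral_gaussWeight ha hd

/-- kernel: the kernel of `gaussApprox` is r18's `gaussWeight a`. [cite: BalabanImbrieJaffe1988, (3.11) p.266] -/
@[simp] theorem gaussApprox_K {a : ℝ} (ha : 0 < a) (hd : 2 ≤ P.d) :
    (gaussApprox (P := P) (j := j) ha hd).K = gaussWeight a := rfl

/-- **The block-averaging datum of (3.11) over r18's concrete axial forest**: frozen bond set `axialBonds` (= `δ_{Ax}` of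
[BalabanImbrieJaffe1985] (3.4) on the torus of record, a forest by `treeOrder_axialBonds`, fresh end `b₊`, rank `blockRank`), with ANY
measurable block averages `Qu` (gauge field) and `Q(u)φ` (scalar field) such that the law of `Qu` under `∫𝒟u δ_{Ax}(u)(·)`
(`axialMeasure`) is absolutely continuous w.r.t. `dv` — the Haar regularity that makes `δ(v/Qu)` a density.
[cite: BalabanImbrieJaffe1988, (3.11) p.266] -/
def axialRTData (hj : j + 1 ≤ P.m + P.K) (qU : GaugeField P j U1 → GaugeField P (j + 1) U1) (hqU : Measurable qU)
    (qH : GaugeField P j U1 → HiggsField P j → HiggsField P (j + 1)) (hqH : Measurable (Function.uncurry qH))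
    (hac : (axialMeasure P j U1).map qU ≪ fieldMeasure P (j + 1) U1) : RTData P j where
  tree := axialBonds
  fresh := fun b => b.tgt
  rank := blockRank
  treeOrder := treeOrder_axialBonds hj
  qU := qU
  measurable_qU := hqU
  qH := qH
  measurable_qH := hqH
  ac_qU := by
    have h := hac
    unfold axialMeasure at h
    rw [Measure.map_map hqU (measurable_fixBonds _)] at h
    convert h using 2
    funext U
    simp only [Function.comp_apply]

/-- kernel: the datum `axialRTData` freezes exactly r18's `axialBonds`. [cite: BalabanImbrieJaffe1988, (3.11) p.266] -/
@[simp] theorem axialRTData_tree (hj : j + 1 ≤ P.m + P.K) (qU : GaugeField P j U1 → GaugeField P (j + 1) U1) (hqU : Measurable qU)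
    (qH : GaugeField P j U1 → HiggsField P j → HiggsField P (j + 1)) (hqH : Measurable (Function.uncurry qH))
    (hac : (axialMeasure P j U1).map qU ≪ fieldMeasure P (j + 1) U1) : (axialRTData hj qU hqU qH hqH hac).tree = axialBonds := rfl

/-! ## §2 kernel: `∫𝒟u δ_{Ax}(u)(·)` as the law of `u ↦ u[T := 1]`, and the push-forward calculus against test functions -/

section Kernel

variable {D : RTData P j} {A : ApproxDelta P j} {ρ : GaugeField P j U1 → HiggsField P j → ℂ}

/-- kernel: for a datum over `axialBonds`, `D.ax u = u[axialBonds := 1]` whichever decidability instance computes the freezing.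
[cite: BalabanImbrieJaffe1985, (3.4) p.306] -/
theorem ax_eq_fixBonds {inst : DecidableEq (PBond P j)} (hD : D.tree = axialBonds) (U : GaugeField P j U1) :
    D.ax U = fixBonds axialBonds U := by
  funext b
  simp only [RTData.ax, hD, fixBonds]

/-- kernel: **`∫𝒟u δ_{Ax}(u)(·)` (r18's `axialMeasure`) is the law of `u ↦ u[T := 1]` under `𝒟u`** for every datum over `axialBonds`.
[cite: BalabanImbrieJaffe1988, (3.11) p.266] -/
theorem axialMeasure_eq_map_ax (hD : D.tree = axialBonds) : axialMeasure P j U1 = (fieldMeasure P j U1).map D.ax := by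
  unfold axialMeasure
  congr 1
  funext U
  exact (ax_eq_fixBonds hD U).symm

/-- kernel: the block map is `(u, ψ) ↦ (Q(u[T := 1]), ψ)`. [cite: BalabanImbrieJaffe1985, (3.5) p.306] -/
theorem blockMap_apply (p : GaugeField P j U1 × HiggsField P (j + 1)) : D.blockMap p = (D.qU (D.ax p.1), p.2) := rfl

/-- kernel: integrating a measurable test function against the pushed-forward law of a real weight `h`: `∫ g d(pushLaw h) =
∫𝒟u𝒟ψ h⁺ · (g ∘ blockMap)`. [cite: BalabanImbrieJaffe1985, (3.5) p.306] -/
theorem integral_pushLaw {h : GaugeField P j U1 × HiggsField P (j + 1) → ℝ} (hh : Integrable h (fineMeasure P j))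
    {g : GaugeField P (j + 1) U1 × HiggsField P (j + 1) → ℂ} (hg : Measurable g) :
    ∫ z, g z ∂D.pushLaw h = ∫ p, (max (h p) 0) • g (D.blockMap p) ∂fineMeasure P j := by
  unfold pushLaw
  rw [integral_map D.measurable_blockMap.aemeasurable hg.aestronglyMeasurable,
    integral_withDensity_eq_integral_toReal_smul₀ hh.1.aemeasurable.ennreal_ofReal
      (Filter.Eventually.of_forall fun _ => ENNReal.ofReal_lt_top)]
  simp only [ENNReal.toReal_ofReal']

/-- kernel: **the Radon–Nikodym density integrates test functions back to the fine lattice** — for a real `𝒟u𝒟ψ`-integrable weight `h`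
and a bounded measurable `g(v, ψ)`, `∫𝒟v𝒟ψ rnReal(h)·g = ∫𝒟u𝒟ψ h · (g ∘ blockMap)` (`Measure.integral_rnDeriv_smul`, absolute continuity
from `ac_qU`). [cite: BalabanImbrieJaffe1985, (3.5) p.306] -/
theorem integral_rnReal_smul {h : GaugeField P j U1 × HiggsField P (j + 1) → ℝ} (hh : Integrable h (fineMeasure P j))
    {g : GaugeField P (j + 1) U1 × HiggsField P (j + 1) → ℂ} (hg : Measurable g) {C : ℝ} (hC : ∀ z, ‖g z‖ ≤ C) :
    ∫ q, (D.rnReal h q) • g q ∂blockMeasure P j = ∫ p, (h p) • g (D.blockMap p) ∂fineMeasure P j := by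
  have hhn : Integrable (fun p => -h p) (fineMeasure P j) := hh.neg
  haveI := isFiniteMeasure_pushLaw (D := D) hh
  haveI := isFiniteMeasure_pushLaw (D := D) hhn
  have hgb : AEStronglyMeasurable (fun p => g (D.blockMap p)) (fineMeasure P j) :=
    (hg.comp D.measurable_blockMap).aestronglyMeasurable
  have I1 : Integrable (fun q => ((D.pushLaw h).rnDeriv (blockMeasure P j) q).toReal • g q) (blockMeasure P j) :=
    Measure.integrable_toReal_rnDeriv.smul_bdd C hg.aestronglyMeasurable (Filter.Eventually.of_forall hC)
  have I2 : Integrable (fun q => ((D.pushLaw fun p => -h p).rnDeriv (blockMeasure P j) q).toReal • g q) (blockMeasure P j) :=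
    Measure.integrable_toReal_rnDeriv.smul_bdd C hg.aestronglyMeasurable (Filter.Eventually.of_forall hC)
  have I3 : Integrable (fun p => (max (h p) 0) • g (D.blockMap p)) (fineMeasure P j) :=
    hh.pos_part.smul_bdd C hgb (Filter.Eventually.of_forall fun p => hC _)
  have I4 : Integrable (fun p => (max (-h p) 0) • g (D.blockMap p)) (fineMeasure P j) :=
    hhn.pos_part.smul_bdd C hgb (Filter.Eventually.of_forall fun p => hC _)
  have e : ∀ q, (D.rnReal h q) • g q = ((D.pushLaw h).rnDeriv (blockMeasure P j) q).toReal • g q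
      - ((D.pushLaw fun p => -h p).rnDeriv (blockMeasure P j) q).toReal • g q := fun q => by
    rw [RTData.rnReal, sub_smul]
  simp_rw [e]
  rw [integral_sub I1 I2, integral_rnDeriv_smul (pushLaw_absolutelyContinuous (D := D) h),
    integral_rnDeriv_smul (pushLaw_absolutelyContinuous (D := D) fun p => -h p), integral_pushLaw hh hg,
    integral_pushLaw hhn hg, ← integral_sub I3 I4]
  refine integral_congr_ae (Filter.Eventually.of_forall fun p => ?_)
  simp only [← sub_smul, max_zero_sub_max_neg_zero_eq_self]

/-- kernel: **`∫𝒟v𝒟ψ (𝒯ρ)(v, ψ) g(v, ψ) = ∫𝒟u𝒟ψ G(u[T := 1], ψ) g(Q(u[T := 1]), ψ)`** for the complex density `𝒯ρ = D.rt A ρ` of (3.3), its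
`𝒟u𝒟ψ`-integrable smeared density `G = D.smearAx A ρ` and every bounded measurable test function `g` (real/imaginary parts by
`integral_rnReal_smul`). [cite: BalabanImbrieJaffe1985, (3.3) p.306] -/
theorem integral_rt_mul (hG : Integrable (D.smearAx A ρ) (fineMeasure P j))
    {g : GaugeField P (j + 1) U1 × HiggsField P (j + 1) → ℂ} (hg : Measurable g) {C : ℝ} (hC : ∀ z, ‖g z‖ ≤ C) :
    ∫ q, Function.uncurry (D.rt A ρ) q * g q ∂blockMeasure P j = ∫ p, D.smearAx A ρ p * g (D.blockMap p) ∂fineMeasure P j := by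
  have hgI : Measurable fun z => I * g z := hg.const_mul I
  have hCI : ∀ z, ‖I * g z‖ ≤ C := fun z => by rw [norm_mul, Complex.norm_I, one_mul]; exact hC z
  have hgb : AEStronglyMeasurable (fun p => g (D.blockMap p)) (fineMeasure P j) :=
    (hg.comp D.measurable_blockMap).aestronglyMeasurable
  have hgbI : AEStronglyMeasurable (fun p => I * g (D.blockMap p)) (fineMeasure P j) :=
    (hgI.comp D.measurable_blockMap).aestronglyMeasurable
  have hre : Integrable (fun p => (D.smearAx A ρ p).re) (fineMeasure P j) := hG.re
  have him : Integrable (fun p => (D.smearAx A ρ p).im) (fineMeasure P j) := hG.im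
  have J1 : Integrable (fun q => (D.rnReal (fun p => (D.smearAx A ρ p).re) q) • g q) (blockMeasure P j) :=
    (integrable_rnReal hre).smul_bdd C hg.aestronglyMeasurable (Filter.Eventually.of_forall hC)
  have J2 : Integrable (fun q => (D.rnReal (fun p => (D.smearAx A ρ p).im) q) • (I * g q)) (blockMeasure P j) :=
    (integrable_rnReal him).smul_bdd C hgI.aestronglyMeasurable (Filter.Eventually.of_forall hCI)
  have J3 : Integrable (fun p => (D.smearAx A ρ p).re • g (D.blockMap p)) (fineMeasure P j) :=
    hre.smul_bdd C hgb (Filter.Eventually.of_forall fun p => hC _)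
  have J4 : Integrable (fun p => (D.smearAx A ρ p).im • (I * g (D.blockMap p))) (fineMeasure P j) :=
    him.smul_bdd C hgbI (Filter.Eventually.of_forall fun p => hCI _)
  have eL : ∀ q, Function.uncurry (D.rt A ρ) q * g q = (D.rnReal (fun p => (D.smearAx A ρ p).re) q) • g q
      + (D.rnReal (fun p => (D.smearAx A ρ p).im) q) • (I * g q) := by
    rintro ⟨V, ψ⟩
    simp only [Function.uncurry_apply_pair, RTData.rt, Complex.real_smul]
    ring
  have eR : ∀ p, D.smearAx A ρ p * g (D.blockMap p) = (D.smearAx A ρ p).re • g (D.blockMap p)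
      + (D.smearAx A ρ p).im • (I * g (D.blockMap p)) := fun p => by
    simp only [Complex.real_smul]
    conv_lhs => rw [← Complex.re_add_im (D.smearAx A ρ p)]
    ring
  simp_rw [eL, eR]
  rw [integral_add J1 J2, integral_add J3 J4, integral_rnReal_smul hre hg hC, integral_rnReal_smul him hgI hCI]

/-- kernel: at a gauge field `u` with `ρ(u, ·)` `𝒟φ`-integrable, the integrand `(ψ, φ) ↦ ρ(u, φ) δ_H(ψ − Q(u)φ)` is `dψ𝒟φ`-integrable
(Tonelli, unit mass of `δ_H`). [cite: BalabanImbrieJaffe1985, (3.6) p.306] -/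
theorem integrable_smearIntegrand (hρm : Measurable (Function.uncurry ρ)) (U : GaugeField P j U1) (hU : Integrable (ρ U)) :
    Integrable (Function.uncurry fun (ψ : HiggsField P (j + 1)) (φ : HiggsField P j) => ρ U φ * (A.K (D.qH U φ) ψ : ℂ))
      ((volume : Measure (HiggsField P (j + 1))).prod volume) := by
  have hm : Measurable (Function.uncurry fun (ψ : HiggsField P (j + 1)) (φ : HiggsField P j) => ρ U φ * (A.K (D.qH U φ) ψ : ℂ)) :=
    ((measurable_section hρm U).comp measurable_snd).mul
      (Complex.measurable_ofReal.comp (A.measurable_K.comp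
        (((D.measurable_qH.comp (measurable_const.prodMk measurable_id)).comp measurable_snd).prodMk measurable_fst)))
  refine ⟨hm.aestronglyMeasurable, ?_⟩
  unfold HasFiniteIntegral
  rw [lintegral_prod _ hm.enorm.aemeasurable]
  simp only [Function.uncurry_apply_pair]
  rw [lintegral_lintegral_norm_smearIntegrand hρm U]
  exact hU.2

/-- kernel: **Fubini over `𝒟φ dψ` at fixed `u`** — `∫dψ G(u, ψ) g(ψ) = ∫𝒟φ ∫dψ ρ(u, φ) δ_H(ψ − Q(u)φ) g(ψ)` for bounded measurable `g`,
when `ρ(u, ·)` is `𝒟φ`-integrable. [cite: BalabanImbrieJaffe1985, (3.3) p.306] -/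
theorem integral_smear_mul (hρm : Measurable (Function.uncurry ρ)) (U : GaugeField P j U1) (hU : Integrable (ρ U))
    {g : HiggsField P (j + 1) → ℂ} (hg : Measurable g) {C : ℝ} (hC : ∀ ψ, ‖g ψ‖ ≤ C) :
    ∫ ψ, D.smear A ρ U ψ * g ψ = ∫ φ, ∫ ψ, ρ U φ * (A.K (D.qH U φ) ψ : ℂ) * g ψ := by
  have hint : Integrable (Function.uncurry fun (ψ : HiggsField P (j + 1)) (φ : HiggsField P j) =>
      ρ U φ * (A.K (D.qH U φ) ψ : ℂ) * g ψ) ((volume : Measure (HiggsField P (j + 1))).prod volume) :=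
    (integrable_smearIntegrand (D := D) (A := A) hρm U hU).mul_bdd ((hg.comp measurable_fst).aestronglyMeasurable)
      (Filter.Eventually.of_forall fun p => hC p.1)
  unfold RTData.smear
  simp_rw [← integral_mul_const]
  exact integral_integral_swap hint

/-- kernel: the (3.11) integrand `(u, φ, ψ) ↦ ρ(u, φ) δ_H(ψ − Q(u)φ) g(Qu, ψ)` integrated over `𝒟φ dψ` is a measurable function of `u`.
[cite: BalabanImbrieJaffe1988, (3.11) p.266] -/
theorem measurable_integral_integral (hρm : Measurable (Function.uncurry ρ))
    {g : GaugeField P (j + 1) U1 × HiggsField P (j + 1) → ℂ} (hg : Measurable g) :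
    Measurable fun U : GaugeField P j U1 => ∫ φ, ∫ ψ, ρ U φ * (A.K (D.qH U φ) ψ : ℂ) * g (D.qU U, ψ) := by
  have hF : Measurable fun q : (GaugeField P j U1 × HiggsField P j) × HiggsField P (j + 1) =>
      ρ q.1.1 q.1.2 * (A.K (D.qH q.1.1 q.1.2) q.2 : ℂ) * g (D.qU q.1.1, q.2) :=
    ((hρm.comp measurable_fst).mul (Complex.measurable_ofReal.comp
      (A.measurable_K.comp ((D.measurable_qH.comp measurable_fst).prodMk measurable_snd)))).mul
      (hg.comp ((D.measurable_qU.comp (measurable_fst.comp measurable_fst)).prodMk measurable_snd))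
  have h2 : StronglyMeasurable fun x : GaugeField P j U1 × HiggsField P j =>
      ∫ ψ, ρ x.1 x.2 * (A.K (D.qH x.1 x.2) ψ : ℂ) * g (D.qU x.1, ψ) :=
    hF.stronglyMeasurable.integral_prod_right' (ν := volume)
  exact (h2.integral_prod_right' (ν := volume)).measurable

/-- kernel: the smeared axial density is `𝒟u𝒟ψ`-integrable as soon as `ρ` is `𝒟u𝒟φ`-integrable IN THE AXIAL GAUGE (no gauge
invariance needed; cf. `BIJ85RT37Normalization.integrable_smearAx`). [cite: BalabanImbrieJaffe1985, (3.3) p.306] -/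
theorem integrable_smearAx_of_integrable_ax (hρm : Measurable (Function.uncurry ρ))
    (hρa : Integrable (Function.uncurry fun U φ => ρ (D.ax U) φ) ((fieldMeasure P j U1).prod volume)) :
    Integrable (D.smearAx A ρ) (fineMeasure P j) := by
  refine ⟨(measurable_smearAx hρm).aestronglyMeasurable, ?_⟩
  have hfin := hρa.2
  unfold HasFiniteIntegral at hfin ⊢
  rw [lintegral_prod _ (measurable_comp_ax (D := D) hρm).enorm.aemeasurable] at hfin
  unfold fineMeasure
  rw [lintegral_prod _ (measurable_smearAx (D := D) (A := A) hρm).enorm.aemeasurable]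
  refine lt_of_le_of_lt (lintegral_mono fun U => ?_) hfin
  calc ∫⁻ ψ, ‖D.smearAx A ρ (U, ψ)‖ₑ ≤ ∫⁻ ψ, ∫⁻ φ, ‖ρ (D.ax U) φ * (A.K (D.qH (D.ax U) φ) ψ : ℂ)‖ₑ :=
        lintegral_mono fun ψ => enorm_integral_le_lintegral_enorm _
    _ = ∫⁻ φ, ‖ρ (D.ax U) φ‖ₑ := lintegral_lintegral_norm_smearIntegrand hρm (D.ax U)

/-- **`𝒯ρ` is `dv dψ`-integrable** for every density that is `𝒟u𝒟φ`-integrable in the axial gauge. [cite: BalabanImbrieJaffe1985, (3.3) p.306] -/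
theorem integrable_rt_of_integrable_ax (hρm : Measurable (Function.uncurry ρ))
    (hρa : Integrable (Function.uncurry fun U φ => ρ (D.ax U) φ) ((fieldMeasure P j U1).prod volume)) :
    Integrable (Function.uncurry (D.rt A ρ)) (blockMeasure P j) := by
  have hG := integrable_smearAx_of_integrable_ax (D := D) (A := A) hρm hρa
  have h1 : Integrable (fun q => (D.rnReal (fun p => (D.smearAx A ρ p).re) q : ℂ)) (blockMeasure P j) :=
    (integrable_rnReal hG.re).ofReal
  have h2 : Integrable (fun q => (D.rnReal (fun p => (D.smearAx A ρ p).im) q : ℂ) * I) (blockMeasure P j) :=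
    (integrable_rnReal hG.im).ofReal.mul_const I
  exact h1.add h2

end Kernel

/-! ## §3 EXISTENCE: the density of [BalabanImbrieJaffe1985] (3.3) satisfies r18's (3.11) `IsRT311` -/

/-- **Existence of `ρ₁^L` for (3.11), axial-gauge form.**  For `a > 0`, `d ≥ 2`, a block-averaging datum `D` over r18's axial forest
(`D.tree = axialBonds`; Haar-regular `Qu`) and a jointly measurable density `ρ₀(u, φ)` that is `𝒟u𝒟φ`-integrable in the axial gauge,
the Radon–Nikodym density `ρ₁ = 𝒯ρ₀` of [BalabanImbrieJaffe1985] (3.3) with `δ_H` = the normalized `ψ`-Gaussian of (3.11)–(3.12)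
satisfies (3.11) in the push-forward reading: `∫dv dψ ρ₁ g = ∫𝒟u δ_{Ax}(u) ∫𝒟φ ∫dψ ρ₀(u, φ) e^{−½aL⁻²⟨ψ − Q(u)φ, ψ − Q(u)φ⟩ − E^{(0)}} g(Qu, ψ)`
for every bounded measurable `g`. [cite: BalabanImbrieJaffe1988, (3.11) p.266] -/
theorem isRT311_rt_of_integrable_ax {a : ℝ} (ha : 0 < a) (hd : 2 ≤ P.d) (D : RTData P j) (hD : D.tree = axialBonds)
    {ρ : GaugeField P j U1 → HiggsField P j → ℂ} (hρm : Measurable (Function.uncurry ρ))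
    (hρa : Integrable (Function.uncurry fun U φ => ρ (D.ax U) φ) ((fieldMeasure P j U1).prod volume)) :
    IsRT311 D.qU D.qH a ρ (D.rt (gaussApprox ha hd) ρ) := by
  intro g hg hgC
  obtain ⟨C, hC⟩ := hgC
  have hG : Integrable (D.smearAx (gaussApprox ha hd) ρ) (fineMeasure P j) := integrable_smearAx_of_integrable_ax hρm hρa
  have hrt : Integrable (fun q => Function.uncurry (D.rt (gaussApprox ha hd) ρ) q * g q)
      ((fieldMeasure P (j + 1) U1).prod volume) :=
    (integrable_rt_of_integrable_ax hρm hρa).mul_bdd hg.aestronglyMeasurable (Filter.Eventually.of_forall hC)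
  have hGg : Integrable (fun p => D.smearAx (gaussApprox ha hd) ρ p * g (D.blockMap p)) ((fieldMeasure P j U1).prod volume) :=
    hG.mul_bdd ((hg.comp D.measurable_blockMap).aestronglyMeasurable) (Filter.Eventually.of_forall fun p => hC _)
  have hL : ∫ v, ∫ ψ, D.rt (gaussApprox ha hd) ρ v ψ * g (v, ψ) ∂volume ∂fieldMeasure P (j + 1) U1 =
      ∫ q, Function.uncurry (D.rt (gaussApprox ha hd) ρ) q * g q ∂blockMeasure P j :=
    (integral_prod _ hrt).symm
  have hR : ∫ p, D.smearAx (gaussApprox ha hd) ρ p * g (D.blockMap p) ∂fineMeasure P j =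
      ∫ U, ∫ ψ, D.smear (gaussApprox ha hd) ρ (D.ax U) ψ * g (D.qU (D.ax U), ψ) ∂volume ∂fieldMeasure P j U1 :=
    integral_prod _ hGg
  have hRHS : ∫ U, ∫ φ, ∫ ψ, ρ U φ * (gaussWeight a (D.qH U φ) ψ : ℂ) * g (D.qU U, ψ) ∂volume ∂volume ∂axialMeasure P j U1 =
      ∫ U, ∫ φ, ∫ ψ, ρ (D.ax U) φ * (gaussWeight a (D.qH (D.ax U) φ) ψ : ℂ) * g (D.qU (D.ax U), ψ) ∂volume ∂volume
        ∂fieldMeasure P j U1 := by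
    rw [axialMeasure_eq_map_ax hD]
    exact integral_map D.measurable_ax.aemeasurable
      (measurable_integral_integral (A := gaussApprox ha hd) hρm hg).aestronglyMeasurable
  rw [hL, integral_rt_mul hG hg hC, hR, hRHS]
  refine integral_congr_ae ?_
  filter_upwards [hρa.prod_right_ae] with U hU
  exact integral_smear_mul hρm (D.ax U) hU (hg.comp measurable_prodMk_left) fun ψ => hC _

/-- **Existence of `ρ₁^L` for (3.11).**  For `a > 0`, `d ≥ 2`, a block-averaging datum `D` over r18's axial forest (`D.tree = axialBonds`,
Haar-regular `Qu`, any measurable `Q(u)φ`) and every density `ρ₀(u, φ)` that is jointly measurable, jointly gauge invariant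
(`BIJ85RT33.JointInvariant`) and `𝒟u𝒟φ`-integrable, the measure-level renormalization transform `ρ₁ := D.rt (gaussApprox ha hd) ρ₀` of
[BalabanImbrieJaffe1985] (3.3) satisfies r18's typed (3.11), `IsRT311 D.qU D.qH a ρ₀ ρ₁` — the item *"NOT DONE HERE: the EXISTENCE of a
density ρ₁ with IsRT311"* of `BIJ88RenormTransf311`, under the Haar regularity `ac_qU`. [cite: BalabanImbrieJaffe1988, (3.11) p.266] -/
theorem isRT311_rt {a : ℝ} (ha : 0 < a) (hd : 2 ≤ P.d) (D : RTData P j) (hD : D.tree = axialBonds)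
    {ρ : GaugeField P j U1 → HiggsField P j → ℂ} (hρm : Measurable (Function.uncurry ρ)) (hρg : JointInvariant ρ)
    (hρi : Integrable (Function.uncurry ρ) ((fieldMeasure P j U1).prod volume)) :
    IsRT311 D.qU D.qH a ρ (D.rt (gaussApprox ha hd) ρ) :=
  isRT311_rt_of_integrable_ax ha hd D hD hρm (integrable_comp_ax hρm hρg hρi)

/-- **Existence of `ρ₁^L` for (3.11) on the concrete datum `axialRTData`** (r18's `axialBonds` / `treeOrder_axialBonds`; measurable
Haar-regular `Qu`, measurable `Q(u)φ`). [cite: BalabanImbrieJaffe1988, (3.11) p.266] -/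
theorem isRT311_axialRTData (hj : j + 1 ≤ P.m + P.K) {a : ℝ} (ha : 0 < a) (hd : 2 ≤ P.d)
    {qU : GaugeField P j U1 → GaugeField P (j + 1) U1} (hqU : Measurable qU)
    {qH : GaugeField P j U1 → HiggsField P j → HiggsField P (j + 1)} (hqH : Measurable (Function.uncurry qH))
    (hac : (axialMeasure P j U1).map qU ≪ fieldMeasure P (j + 1) U1)
    {ρ : GaugeField P j U1 → HiggsField P j → ℂ} (hρm : Measurable (Function.uncurry ρ)) (hρg : JointInvariant ρ)
    (hρi : Integrable (Function.uncurry ρ) ((fieldMeasure P j U1).prod volume)) :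
    IsRT311 qU qH a ρ ((axialRTData hj qU hqU qH hqH hac).rt (gaussApprox ha hd) ρ) :=
  isRT311_rt ha hd (axialRTData hj qU hqU qH hqH hac) rfl hρm hρg hρi

/-- **(3.13) for the CONSTRUCTED density** — r18's `BIJ88RenormTransf311.eq313` with its hypothesis `IsRT311 …` discharged by `isRT311_rt`:
for the model's `ρ₀ = F e^{−S}` (`rho0`, jointly gauge-invariant measurable observable `F`, `𝒟u𝒟φ`-integrable `ρ₀`) and a datum `D` over
`axialBonds`, `[F] = ∫dv dψ (𝒯ρ₀)(v, ψ)`. [cite: BalabanImbrieJaffe1988, (3.13) p.267] -/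
theorem eq313_rt (hj : j + 1 ≤ P.m + P.K) (hd : 2 ≤ P.d) {a ε : ℝ} (ha : 0 < a) (hε : 0 < ε) (e lam dm2 E₀ E₁ : ℝ)
    (D : RTData P j) (hD : D.tree = axialBonds)
    {F : GaugeField P j U1 → HiggsField P j → ℂ} (hFm : Measurable (Function.uncurry F)) (hFg : JointInvariant F)
    (hFi : Integrable (Function.uncurry (rho0 ε e lam dm2 E₀ E₁ F)) ((fieldMeasure P j U1).prod volume)) :
    bracket (actionU1 (ε ^ P.d) ε⁻¹ e lam dm2 E₀ E₁) F =
      ∫ v, ∫ ψ, D.rt (gaussApprox ha hd) (rho0 ε e lam dm2 E₀ E₁ F) v ψ ∂volume ∂fieldMeasure P (j + 1) U1 :=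
  eq313 hj hd ha hε e lam dm2 E₀ E₁ hFm hFg
    (isRT311_rt ha hd D hD (measurable_rho0 ε e lam dm2 E₀ E₁ hFm) (fun g U φ => rho0_gaugeAct ε e lam dm2 E₀ E₁ hFg g U φ) hFi)

/-! ## §4 (v1.1, append-only) NON-VACUITY of the Haar regularity: the crossing-bond decimation in the complete axial gauge

The hypothesis `hac : (axialMeasure P j U1).map Qu ≪ dv` of `axialRTData` (= `BIJ85RT33.RTData.ac_qU` over r18's forest) is
satisfied — with EQUALITY `= dv` — by the decimation `crossAvg U c = U(crossBond c)` onto the bonds through which the straight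
lines of `Balaban1983to89.AveragingRT` (B4 (1.7)) leave the blocks: such a bond is never a tree bond of `axialBonds`, the
bonds of distinct coarse bonds are distinct, so under `∫𝒟u δ_{Ax}(u)(·)` the values `u(crossBond c)` are i.i.d. Haar
(Weil's right-invariance argument of `AveragingRT.map_axialAvg`).  Hence a block-averaging datum over `axialBonds` with NO
hypothesis on the gauge average (`crossRTData`), and (3.11)-existence / (3.13) for it. -/

section CrossingBonds

/-- The CROSSING BOND of the coarse bond `c = ⟨y, y + e_μ⟩`: the `((L−1)/2)`-th bond of the straight line of `c`
(`AveragingRT.line`, centred labelling — B4 (1.7) `U(Γ)` along straight lines), i.e. the fine bond `⟨x, x + e_μ⟩` whose source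
`x` is the last site of the block `B(y)` on that line (offset `L − 1` in the direction `μ`). [cite: Balaban1984PropagatorsI, (1.7) p.18] -/
def crossBond (c : PBond P (j + 1)) : PBond P j := AveragingRT.line c ((P.L - 1) / 2)

/-- kernel: the crossing bond points in the direction of its coarse bond. [cite: Balaban1984PropagatorsI, (1.7) p.18] -/
@[simp] theorem crossBond_dir (c : PBond P (j + 1)) : (crossBond c).dir = c.dir := rfl

/-- kernel: the source of the crossing bond sits at offset `L − 1` of its block in the direction of the bond (standing range).
[cite: BalabanImbrieJaffe1985, (3.4) p.306] -/
theorem inBlock_crossBond_src (hj : j + 1 ≤ P.m + P.K) (c : PBond P (j + 1)) :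
    BIJ88RenormTransf311.inBlock (crossBond c).src c.dir = P.L - 1 := by
  have h : (crossBond c).src = Site.blockSite c.src (AveragingRT.offLo P c.dir ((P.L - 1) / 2) le_rfl) :=
    AveragingRT.lineSite_eq_lo hj c le_rfl
  unfold BIJ88RenormTransf311.inBlock
  rw [h, Site.val_blockSite hj, Nat.mul_add_mod']
  have hoff : ((AveragingRT.offLo P c.dir ((P.L - 1) / 2) le_rfl c.dir : Fin P.L) : ℕ) = (P.L - 1) / 2 + (P.L - 1) / 2 := by
    simp [AveragingRT.offLo]
  rw [hoff, Nat.mod_eq_of_lt] <;> · have := AveragingRT.two_mul_half_add_one P; omega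

/-- kernel: **a crossing bond is never a tree bond of the axial forest** (`u_b = 1` is imposed only inside the blocks, [2] (3.4)).
[cite: BalabanImbrieJaffe1985, (3.4) p.306] -/
theorem crossBond_not_mem_axialBonds (hj : j + 1 ≤ P.m + P.K) (c : PBond P (j + 1)) :
    crossBond c ∉ (axialBonds : Finset (PBond P j)) := by
  rw [BIJ88RenormTransf311.mem_axialBonds]
  intro h
  have h2 := h.2
  rw [crossBond_dir, inBlock_crossBond_src hj c] at h2
  omega

/-- kernel: distinct coarse bonds have distinct crossing bonds (standing range). [cite: Balaban1984PropagatorsI, (1.7) p.18] -/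
theorem crossBond_injective (hj : j + 1 ≤ P.m + P.K) : Function.Injective (crossBond : PBond P (j + 1) → PBond P j) := by
  intro c c' h
  have hdir : (crossBond c).dir = (crossBond c').dir := congrArg PBond.dir h
  rw [crossBond_dir, crossBond_dir] at hdir
  have hsrc : (crossBond c).src = (crossBond c').src := congrArg PBond.src h
  have e1 : (crossBond c).src = Site.blockSite c.src (AveragingRT.offLo P c.dir ((P.L - 1) / 2) le_rfl) :=
    AveragingRT.lineSite_eq_lo hj c le_rfl
  have e2 : (crossBond c').src = Site.blockSite c'.src (AveragingRT.offLo P c'.dir ((P.L - 1) / 2) le_rfl) :=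
    AveragingRT.lineSite_eq_lo hj c' le_rfl
  rw [e1, e2] at hsrc
  have h1 := (AveragingRT.blockSite_inj hj hsrc).1
  cases c
  cases c'
  simp only at hdir h1
  subst hdir
  subst h1
  rfl

/-- **The crossing-bond decimation** `(Q̄u)(c) = u(crossBond c)`: a block average of the gauge field reading, for every coarse bond,
the one bond variable of its line that the complete axial gauge `δ_{Ax}` leaves free inside `B(c₋) ∪ B(c₊)`'s line segment crossing
(a non-vacuity witness for the DATA `Qu` of (3.11); the printed average is [2] (2.10)). [cite: BalabanImbrieJaffe1988, (3.11) p.266] -/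
def crossAvg (U : GaugeField P j U1) : GaugeField P (j + 1) U1 := fun c => U (crossBond c)

/-- kernel: the crossing-bond decimation is measurable. [cite: BalabanImbrieJaffe1988, (3.11) p.266] -/
theorem measurable_crossAvg : Measurable (crossAvg : GaugeField P j U1 → GaugeField P (j + 1) U1) :=
  measurable_pi_iff.mpr fun c => measurable_pi_apply (crossBond c)

/-- kernel: the crossing-bond decimation does not see the axial gauge fixing (`u[axialBonds := 1]` agrees with `u` on every crossing
bond). [cite: BalabanImbrieJaffe1985, (3.4) p.306] -/
theorem crossAvg_fixBonds {inst : DecidableEq (PBond P j)} (hj : j + 1 ≤ P.m + P.K) (U : GaugeField P j U1) :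
    crossAvg (fixBonds axialBonds U) = crossAvg U := by
  funext c
  exact T4AxialGaugeFixing.fixBonds_apply_of_not_mem (crossBond_not_mem_axialBonds hj c) U

/-- kernel: **Haar compatibility of the crossing-bond decimation**, `(Q̄)_* 𝒟u = dv` — the push-forward is right-invariant (translate
the crossing bonds, which are distinct: `crossBond_injective`) and finite, `dv` is left-invariant, and Weil's uniqueness
(`AveragingRT.measure_eq_mass_smul_of_invariant`) applies, exactly as in `AveragingRT.map_axialAvg`. [cite: BalabanImbrieJaffe1985, (3.5) p.306] -/
theorem map_crossAvg (hj : j + 1 ≤ P.m + P.K) :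
    (fieldMeasure P j U1).map (crossAvg : GaugeField P j U1 → GaugeField P (j + 1) U1) = fieldMeasure P (j + 1) U1 := by
  letI : Group (GaugeField P (j + 1) U1) := Pi.group
  letI : MeasurableMul₂ (GaugeField P (j + 1) U1) := Pi.measurableMul₂
  have hmeas : Measurable (crossAvg : GaugeField P j U1 → GaugeField P (j + 1) U1) := measurable_crossAvg
  have h := AveragingRT.measure_eq_mass_smul_of_invariant (fieldMeasure P (j + 1) U1)
    ((fieldMeasure P j U1).map (crossAvg : GaugeField P j U1 → GaugeField P (j + 1) U1)) ?_ ?_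
  · rw [h, Measure.map_apply hmeas MeasurableSet.univ, Set.preimage_univ, measure_univ, one_smul]
  · intro g
    exact (AveragingRT.measurePreserving_mulLeft (P := P) (j := j + 1) g).map_eq
  · intro g
    set R : GaugeField P j U1 → GaugeField P j U1 := fun U b =>
      U b * Function.extend (crossBond : PBond P (j + 1) → PBond P j) g (fun _ => 1) b with hR
    have hRmp : MeasurePreserving R (fieldMeasure P j U1) (fieldMeasure P j U1) := AveragingRT.measurePreserving_mulRight _
    have hcomp : ((fun x => x * g) ∘ (crossAvg : GaugeField P j U1 → GaugeField P (j + 1) U1)) = crossAvg ∘ R := by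
      funext U
      funext c
      show crossAvg U c * g c = R U (crossBond c)
      rw [hR]
      show U (crossBond c) * g c = U (crossBond c) * Function.extend crossBond g (fun _ => 1) (crossBond c)
      rw [(crossBond_injective hj).extend_apply]
    calc ((fieldMeasure P j U1).map crossAvg).map (fun x => x * g)
        = (fieldMeasure P j U1).map ((fun x => x * g) ∘ crossAvg) := Measure.map_map (measurable_mul_const g) hmeas
      _ = (fieldMeasure P j U1).map (crossAvg ∘ R) := by rw [hcomp]
      _ = ((fieldMeasure P j U1).map R).map crossAvg := (Measure.map_map hmeas hRmp.measurable).symm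
      _ = (fieldMeasure P j U1).map crossAvg := by rw [hRmp.map_eq]

/-- **The Haar regularity `hac` HOLDS for the crossing-bond decimation, with equality**: under `∫𝒟u δ_{Ax}(u)(·)` (r18's
`axialMeasure`) the law of `Q̄u` is exactly `dv`. [cite: BalabanImbrieJaffe1985, (3.5) p.306] -/
theorem map_crossAvg_axialMeasure (hj : j + 1 ≤ P.m + P.K) :
    (axialMeasure P j U1).map (crossAvg : GaugeField P j U1 → GaugeField P (j + 1) U1) = fieldMeasure P (j + 1) U1 := by
  unfold axialMeasure
  rw [Measure.map_map measurable_crossAvg (measurable_fixBonds _)]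
  have e : (crossAvg : GaugeField P j U1 → GaugeField P (j + 1) U1) ∘ fixBonds axialBonds = crossAvg :=
    funext fun U => crossAvg_fixBonds hj U
  rw [e, map_crossAvg hj]

/-- **A block-averaging datum of (3.11) over r18's axial forest with NO hypothesis on the gauge average**: the crossing-bond
decimation `crossAvg` (Haar regularity by `map_crossAvg_axialMeasure`) and ANY measurable scalar block average `Q(u)φ`; in
particular `BIJ85RT33.RTData` over `axialBonds` is inhabited. [cite: BalabanImbrieJaffe1988, (3.11) p.266] -/
def crossRTData (hj : j + 1 ≤ P.m + P.K) (qH : GaugeField P j U1 → HiggsField P j → HiggsField P (j + 1))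
    (hqH : Measurable (Function.uncurry qH)) : RTData P j :=
  axialRTData hj crossAvg measurable_crossAvg qH hqH (Measure.absolutelyContinuous_of_eq (map_crossAvg_axialMeasure hj))

/-- kernel: `crossRTData` freezes r18's `axialBonds`. [cite: BalabanImbrieJaffe1988, (3.11) p.266] -/
@[simp] theorem crossRTData_tree (hj : j + 1 ≤ P.m + P.K) (qH : GaugeField P j U1 → HiggsField P j → HiggsField P (j + 1))
    (hqH : Measurable (Function.uncurry qH)) : (crossRTData hj qH hqH).tree = axialBonds := rfl

/-- **Existence of `ρ₁^L` for (3.11), hypothesis-free in the gauge average**: with `Qu` the crossing-bond decimation and any measurable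
`Q(u)φ`, for `a > 0`, `d ≥ 2` and every jointly measurable, jointly gauge-invariant, `𝒟u𝒟φ`-integrable density `ρ₀`, the density
`𝒯ρ₀` of [BalabanImbrieJaffe1985] (3.3) satisfies r18's `IsRT311`. [cite: BalabanImbrieJaffe1988, (3.11) p.266] -/
theorem isRT311_crossRTData (hj : j + 1 ≤ P.m + P.K) {a : ℝ} (ha : 0 < a) (hd : 2 ≤ P.d)
    {qH : GaugeField P j U1 → HiggsField P j → HiggsField P (j + 1)} (hqH : Measurable (Function.uncurry qH))
    {ρ : GaugeField P j U1 → HiggsField P j → ℂ} (hρm : Measurable (Function.uncurry ρ)) (hρg : JointInvariant ρ)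
    (hρi : Integrable (Function.uncurry ρ) ((fieldMeasure P j U1).prod volume)) :
    IsRT311 crossAvg qH a ρ ((crossRTData hj qH hqH).rt (gaussApprox ha hd) ρ) :=
  isRT311_rt ha hd (crossRTData hj qH hqH) rfl hρm hρg hρi

/-- **(3.13) for a fully specified datum** — r18's `eq313` for the density constructed over `crossRTData` (model's `ρ₀ = F e^{−S}`,
jointly gauge-invariant measurable `F`, `𝒟u𝒟φ`-integrable `ρ₀`; any measurable `Q(u)φ`): `[F] = ∫dv dψ (𝒯ρ₀)(v, ψ)`, with no
hypothesis left on the block averages. [cite: BalabanImbrieJaffe1988, (3.13) p.267] -/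
theorem eq313_crossRTData (hj : j + 1 ≤ P.m + P.K) (hd : 2 ≤ P.d) {a ε : ℝ} (ha : 0 < a) (hε : 0 < ε) (e lam dm2 E₀ E₁ : ℝ)
    {qH : GaugeField P j U1 → HiggsField P j → HiggsField P (j + 1)} (hqH : Measurable (Function.uncurry qH))
    {F : GaugeField P j U1 → HiggsField P j → ℂ} (hFm : Measurable (Function.uncurry F)) (hFg : JointInvariant F)
    (hFi : Integrable (Function.uncurry (rho0 ε e lam dm2 E₀ E₁ F)) ((fieldMeasure P j U1).prod volume)) :
    bracket (actionU1 (ε ^ P.d) ε⁻¹ e lam dm2 E₀ E₁) F =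
      ∫ v, ∫ ψ, (crossRTData hj qH hqH).rt (gaussApprox ha hd) (rho0 ε e lam dm2 E₀ E₁ F) v ψ ∂volume ∂fieldMeasure P (j + 1) U1 :=
  eq313_rt hj hd ha hε e lam dm2 E₀ E₁ (crossRTData hj qH hqH) rfl hFm hFg hFi

end CrossingBonds

end

end Literature.MathematicalPhysics.QuantumFieldTheory.BalabanImbrieJaffe1984to88.BIJ88RT311Exists
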